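import Literature.NumberTheory.DiophantineGeometry.ConductorExponentLeFiveProofs
import HarnessLib

/-!
# Tate's algorithm at `p = 3`: exact valuations of `c₄, c₆, Δ` at the exits II, III, IV

`Proofs` file (theorems only; no definition, no named fact) in topic
`NumberTheory/DiophantineGeometry`, companion of `TateAlgorithm`, `TateAlgorithmLocal` and
`ConductorExponentLeFiveProofs` (whose branch-by-branch walk at `p = 3`,
`TateAlgorithm.addVal_Δ_toNat_le_numComponents_add_four`, proved the BOUNDS `ord Δ ≤ m + 4`).
Here the bounds are sharpened to the EXACT triples `(ord c₄, ord c₆, ord Δ)` at the exits of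
Steps 3, 4, 5 (Kodaira types II, III, IV) of Silverman, *ATAEC* IV.9.4, over a discrete
valuation ring `R` in which `2` is a unit and `3` is a uniformiser (absolutely unramified residue
characteristic `3`). This is the `p = 3` content of I. Papadopoulos, *Sur la classification de
Néron des courbes elliptiques en caractéristique résiduelle 2 et 3*, J. Number Theory 44 (1993)
119–152, Table III / §2, in the form tabulated by O. G. Rizzo, Compositio Math. 136 (2003), Table II
(rows II: `(≥2,3,3)`, `(2,4,3)`, `(2,3,4)`, `(≥3,4,5)`; III: `(≥2,3,3)`, `(2,≥5,3)`; IV: `(2,3,5)`,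
`(3,5,6)`, `(≥4,5,7)` of the reduced triple `(v(c₄), v(c₆), v(Δ))`), and it is the first file of the
kernel discharge of the named fact `WeierstrassCurve.conductorExponent_eq_tableConductorExponentThree`
(`Literature.NumberTheory.EllipticCurves.RootNumberTableThree`; cell `b2b-bsdres`, team n1011, ROW T-PAP3).

## Method

All normalising changes of variables of IV.9.4 have `u = 1`, so `c₄, c₆, Δ` are those of the
normalised model of the terminating step. On that model write `b₂ = 3β`, `b₄ = 3B₄`,
`b₆ = 3B₆` (Steps 3–4) and use the identities (`c₄_of_b_three`, `c₆_of_b_three`,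
`four_Δ_of_b_three`)
`c₄ = 9(β² − 8B₄)`, `c₆ = 27(−β³ + 12βB₄ − 24B₆)`,
`4Δ = 27(−32B₄³ + 3(−β³B₆ + β²B₄² − 12B₆² + 12βB₄B₆))`;
a case distinction on `3 ∣ β`, `3 ∣ B₄` shows that one term dominates each invariant.
The two rows `(≥2, 3, 3)` shared by types II and III are told apart in Rizzo's table by the
"special condition" `c₆'² + 2 ≡ 3c_{4,2} (mod 9)`; `sq_add_two_sub_three_mul_eq` records the ring
identity behind it: with `C₆ = c₆/27`, `C₄ = c₄/9` and `3 ∣ β² − 1` (residue field `𝔽₃`),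
`C₆² + 2 − 3C₄ ≡ 3β³B₆ (mod 9)`, so the condition holds iff `3 ∣ B₆`, i.e. iff Step 3 does NOT
fire. The residue-field-specific reading is left to the file over `ℚ₃`; here only intrinsic data
(units / divisibility of `β, B₄, B₆`) are produced, valid over any such `R`.

## References

* J. H. Silverman, *Advanced Topics in the Arithmetic of Elliptic Curves*, GTM 151 (1994), IV.9.4
  Steps 3–5 and Table 4.1. [Silverman1994]
* I. Papadopoulos, J. Number Theory 44 (1993) 119–152, §2 and Table III (`p = 3`). [Papadopoulos1993]
* O. G. Rizzo, Compositio Math. 136 (2003) 1–23, Table II (p. 4). [Rizzo2003]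
-/

open Polynomial IsLocalRing
open IsDiscreteValuationRing hiding maximalIdeal

namespace Literature.NumberTheory.DiophantineGeometry

namespace TateAlgorithm

/-! ### Identities with the uniformiser `3` -/

section Identities

variable {R : Type*} [CommRing R] (W : WeierstrassCurve R)

/-- `c₄ = 9(β² − 8B₄)` when `b₂ = 3β`, `b₄ = 3B₄`. [cite: Silverman1994, IV.9.4 (the quantities b₂, b₄, b₆, c₄, c₆, Δ of the model; AEC III.1)] -/
theorem c₄_of_b_three {β B₄ : R} (hb₂ : W.b₂ = 3 * β) (hb₄ : W.b₄ = 3 * B₄) :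
    W.c₄ = 9 * (β ^ 2 - 8 * B₄) := by
  simp only [WeierstrassCurve.c₄]; rw [hb₂, hb₄]; ring

/-- `c₆ = 27(−β³ + 12βB₄ − 24B₆)` when `b₂ = 3β`, `b₄ = 3B₄`, `b₆ = 3B₆`. [cite: Silverman1994, IV.9.4 (the quantities b₂, b₄, b₆, c₄, c₆, Δ of the model; AEC III.1)] -/
theorem c₆_of_b_three {β B₄ B₆ : R} (hb₂ : W.b₂ = 3 * β) (hb₄ : W.b₄ = 3 * B₄)
    (hb₆ : W.b₆ = 3 * B₆) : W.c₆ = 27 * (-β ^ 3 + 12 * β * B₄ - 24 * B₆) := by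
  simp only [WeierstrassCurve.c₆]; rw [hb₂, hb₄, hb₆]; ring

/-- `4Δ = 27(−32B₄³ + 3(−β³B₆ + β²B₄² − 12B₆² + 12βB₄B₆))` when `b₂ = 3β`, `b₄ = 3B₄`,
`b₆ = 3B₆` (from `four_mul_Δ_eq`). [folklore] -/
private theorem four_Δ_of_b_three {β B₄ B₆ : R} (hb₂ : W.b₂ = 3 * β) (hb₄ : W.b₄ = 3 * B₄)
    (hb₆ : W.b₆ = 3 * B₆) :
    4 * W.Δ = 27 * (-32 * B₄ ^ 3 +
      3 * (-β ^ 3 * B₆ + β ^ 2 * B₄ ^ 2 - 12 * B₆ ^ 2 + 12 * β * B₄ * B₆)) := by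
  rw [four_mul_Δ_eq, hb₂, hb₄, hb₆]; ring

/-- The ring identity behind Rizzo's special condition on the rows `(≥2, 3, 3)`: with
`C₆ = −β³ + 12βB₄ − 24B₆` (`= c₆/27`) and `C₄ = β² − 8B₄` (`= c₄/9`),
`C₆² + 2 − 3C₄ = 3β³B₆ + (β² − 1)·((β² − 1)² + 3((β² − 1) − 8B₄(β² − 1) − 16B₄)) + 9·P`.
Hence if `3 ∣ β² − 1` then `C₆² + 2 − 3C₄ ≡ 3β³B₆ (mod 9)`. [cite: Rizzo2003, Table II (p. 4), rows (≥2,3,3)] -/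
theorem sq_add_two_sub_three_mul_eq (β B₄ B₆ : R) :
    (-β ^ 3 + 12 * β * B₄ - 24 * B₆) ^ 2 + 2 - 3 * (β ^ 2 - 8 * B₄) =
      3 * (β ^ 3 * B₆) +
        (β ^ 2 - 1) * ((β ^ 2 - 1) ^ 2 + 3 * ((β ^ 2 - 1) - 8 * B₄ * (β ^ 2 - 1) - 16 * B₄)) +
        9 * (5 * β ^ 3 * B₆ + 16 * β ^ 2 * B₄ ^ 2 - 64 * β * B₄ * B₆ + 64 * B₆ ^ 2) := by
  ring

end Identities

/-! ### The exits of Steps 3, 4, 5 -/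

section Exits

variable {R : Type*} [CommRing R] [IsDomain R] [IsDiscreteValuationRing R]

omit [IsDomain R] [IsDiscreteValuationRing R] in
/-- Small units when `2 ∈ Rˣ`: `8`. [folklore] -/
private theorem isUnit_eight (h2 : IsUnit (2 : R)) : IsUnit (8 : R) := by
  have : (8 : R) = 2 ^ 3 := by norm_num
  rw [this]; exact h2.pow 3

/-- If `3 ∣ x² − 1` for every unit `x` (residue field `𝔽₃`) then `9 ∣ C₆² + 2 − 3C₄ ↔ 3 ∣ B₆`
for a unit `β`, in the notation of `sq_add_two_sub_three_mul_eq`. This is the arithmetic of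
Rizzo's special condition on the rows `(≥2,3,3)`. [cite: Rizzo2003, Table II (p. 4), rows (≥2,3,3)] -/
theorem nine_dvd_sq_add_two_sub_iff (h3 : Irreducible (3 : R))
    (hF : ∀ x : R, IsUnit x → (3 : R) ∣ x ^ 2 - 1) {β : R} (hβ : IsUnit β) (B₄ B₆ : R) :
    (9 : R) ∣ (-β ^ 3 + 12 * β * B₄ - 24 * B₆) ^ 2 + 2 - 3 * (β ^ 2 - 8 * B₄) ↔ (3 : R) ∣ B₆ := by
  obtain ⟨t, ht⟩ := hF β hβ
  have h9 : (9 : R) = 3 * 3 := by norm_num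
  have key : (-β ^ 3 + 12 * β * B₄ - 24 * B₆) ^ 2 + 2 - 3 * (β ^ 2 - 8 * B₄) =
      3 * (β ^ 3 * B₆) + 9 * (3 * t ^ 3 + 3 * t ^ 2 - 24 * B₄ * t ^ 2 - 16 * B₄ * t +
        (5 * β ^ 3 * B₆ + 16 * β ^ 2 * B₄ ^ 2 - 64 * β * B₄ * B₆ + 64 * B₆ ^ 2)) := by
    rw [sq_add_two_sub_three_mul_eq, ht]; ring
  rw [key]
  constructor
  · intro h
    have h3d : (3 : R) * 3 ∣ 3 * (β ^ 3 * B₆) := by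
      rw [← h9]; exact (dvd_add_left (dvd_mul_right (9 : R) _)).mp h
    have : (3 : R) ∣ β ^ 3 * B₆ := (mul_dvd_mul_iff_left h3.ne_zero).mp h3d
    rcases h3.prime.dvd_or_dvd this with h | h
    · exact absurd (h3.prime.dvd_of_dvd_pow h) ((isUnit_iff_not_dvd h3 β).mp hβ)
    · exact h
  · rintro ⟨B₆', rfl⟩
    exact dvd_add ⟨β ^ 3 * B₆', by rw [h9]; ring⟩ (dvd_mul_right 9 _)

/-- **Exit II (Step 3) at `p = 3`: the exact invariants.** On a model with `3 ∣ a₃, a₄, a₆`,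
`3 ∣ b₂` and `9 ∤ a₆` (Silverman *ATAEC* IV.9.4, Step 3 fires: type II, `m = 1`), write
`b₂ = 3β`, `b₄ = 3B₄`, `b₆ = 3B₆`; then `B₆ ∈ Rˣ` and exactly one of:
`β, B₄ ∈ Rˣ`: `9 ∣ c₄`, `ord c₆ = 3`, `ord Δ = 3` (row `(≥2, 3, 3)`, `f = 3`);
`3 ∣ β`, `B₄ ∈ Rˣ`: `(2, 4, 3)` (`f = 3`); `β ∈ Rˣ`, `3 ∣ B₄`: `(2, 3, 4)` (`f = 4`);
`3 ∣ β, B₄`: `27 ∣ c₄`, `ord c₆ = 4`, `ord Δ = 5` (row `(≥3, 4, 5)`, `f = 5`).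
[cite: Silverman1994, IV.9.4 Step 3 and Table 4.1] [cite: Rizzo2003, Table II (p. 4), rows II] -/
theorem exitII_values (h2 : IsUnit (2 : R)) (h3 : Irreducible (3 : R)) (W : WeierstrassCurve R)
    (ha₃ : (3 : R) ∣ W.a₃) (ha₄ : (3 : R) ∣ W.a₄) (ha₆ : (3 : R) ∣ W.a₆) (hb₂ : (3 : R) ∣ W.b₂)
    (h6 : ¬ (3 : R) ^ 2 ∣ W.a₆) :
    ∃ β B₄ B₆ : R, W.b₂ = 3 * β ∧ W.b₄ = 3 * B₄ ∧ W.b₆ = 3 * B₆ ∧ IsUnit B₆ ∧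
      ((IsUnit β ∧ IsUnit B₄ ∧ (9 : R) ∣ W.c₄ ∧ (addVal R W.c₆).toNat = 3 ∧
          (addVal R W.Δ).toNat = 3) ∨
        (¬ IsUnit β ∧ IsUnit B₄ ∧ (addVal R W.c₄).toNat = 2 ∧ (addVal R W.c₆).toNat = 4 ∧
          (addVal R W.Δ).toNat = 3) ∨
        (IsUnit β ∧ ¬ IsUnit B₄ ∧ (addVal R W.c₄).toNat = 2 ∧ (addVal R W.c₆).toNat = 3 ∧
          (addVal R W.Δ).toNat = 4) ∨
        (¬ IsUnit β ∧ ¬ IsUnit B₄ ∧ (27 : R) ∣ W.c₄ ∧ (addVal R W.c₆).toNat = 4 ∧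
          (addVal R W.Δ).toNat = 5)) := by
  obtain ⟨γ, hγ⟩ := ha₃
  obtain ⟨q, hq⟩ := ha₄
  obtain ⟨r, hr⟩ := ha₆
  obtain ⟨β, hβ⟩ := hb₂
  have h4 : IsUnit (4 : R) := isUnit_four h2
  have h8 : IsUnit (8 : R) := isUnit_eight h2
  have h32 : IsUnit (32 : R) := isUnit_32 h2
  have hru : IsUnit r := by
    rw [isUnit_iff_not_dvd h3]
    intro h; apply h6; rw [hr, pow_two]; exact mul_dvd_mul_left 3 h
  have hb₄ := b₄_of_a W 3 hγ hq
  have hb₆ := b₆_of_a W 3 hγ hr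
  set B₄ : R := 2 * q + W.a₁ * γ with hB₄def
  set B₆ : R := 4 * r + 3 * γ ^ 2 with hB₆def
  have hB₆ : IsUnit B₆ := isUnit_add_mul_of_isUnit h3 (h4.mul hru) _
  have hc₄ := c₄_of_b_three W hβ hb₄
  have hc₆ := c₆_of_b_three W hβ hb₄ hb₆
  have hΔ := four_Δ_of_b_three W hβ hb₄ hb₆
  refine ⟨β, B₄, B₆, hβ, hb₄, hb₆, hB₆, ?_⟩
  by_cases hB₄ : IsUnit B₄
  · by_cases hβu : IsUnit β
    · -- row (≥2, 3, 3)
      refine Or.inl ⟨hβu, hB₄, ⟨β ^ 2 - 8 * B₄, hc₄⟩, ?_, ?_⟩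
      · have e : 1 * W.c₆ = 3 ^ 3 * (-β ^ 3 + 3 * (4 * β * B₄ - 8 * B₆)) := by
          rw [hc₆]; ring
        exact addVal_toNat_eq_of_eq_add h3 isUnit_one (hβu.pow 3).neg e
      · have e : 4 * W.Δ = 3 ^ 3 * (-32 * B₄ ^ 3 +
            3 * (-β ^ 3 * B₆ + β ^ 2 * B₄ ^ 2 - 12 * B₆ ^ 2 + 12 * β * B₄ * B₆)) := by
          rw [hΔ]; ring
        exact addVal_toNat_eq_of_eq_add h3 h4 (h32.neg.mul (hB₄.pow 3)) e
    · -- row (2, 4, 3)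
      obtain ⟨β', hβ'⟩ := (not_isUnit_iff_dvd h3 _).mp hβu
      refine Or.inr (Or.inl ⟨hβu, hB₄, ?_, ?_, ?_⟩)
      · have e : 1 * W.c₄ = 3 ^ 2 * (-(8 * B₄) + 3 * (3 * β' ^ 2)) := by
          rw [hc₄, hβ']; ring
        exact addVal_toNat_eq_of_eq_add h3 isUnit_one (h8.mul hB₄).neg e
      · have e : 1 * W.c₆ = 3 ^ 4 * (-(8 * B₆) + 3 * (-(3 * β' ^ 3) + 4 * β' * B₄)) := by
          rw [hc₆, hβ']; ring
        exact addVal_toNat_eq_of_eq_add h3 isUnit_one (h8.mul hB₆).neg e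
      · have e : 4 * W.Δ = 3 ^ 3 * (-32 * B₄ ^ 3 +
            3 * (-(27 * β' ^ 3) * B₆ + 9 * β' ^ 2 * B₄ ^ 2 - 12 * B₆ ^ 2 +
              36 * β' * B₄ * B₆)) := by
          rw [hΔ, hβ']; ring
        exact addVal_toNat_eq_of_eq_add h3 h4 (h32.neg.mul (hB₄.pow 3)) e
  · obtain ⟨B₄', hB₄'⟩ := (not_isUnit_iff_dvd h3 _).mp hB₄
    by_cases hβu : IsUnit β
    · -- row (2, 3, 4)
      refine Or.inr (Or.inr (Or.inl ⟨hβu, hB₄, ?_, ?_, ?_⟩))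
      · have e : 1 * W.c₄ = 3 ^ 2 * (β ^ 2 + 3 * (-(8 * B₄'))) := by
          rw [hc₄, hB₄']; ring
        exact addVal_toNat_eq_of_eq_add h3 isUnit_one (hβu.pow 2) e
      · have e : 1 * W.c₆ = 3 ^ 3 * (-β ^ 3 + 3 * (12 * β * B₄' - 8 * B₆)) := by
          rw [hc₆, hB₄']; ring
        exact addVal_toNat_eq_of_eq_add h3 isUnit_one (hβu.pow 3).neg e
      · have e : 4 * W.Δ = 3 ^ 4 * (-β ^ 3 * B₆ +
            3 * (-(96 * B₄' ^ 3) + 3 * β ^ 2 * B₄' ^ 2 - 4 * B₆ ^ 2 + 12 * β * B₄' * B₆)) := by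
          rw [hΔ, hB₄']; ring
        exact addVal_toNat_eq_of_eq_add h3 h4 ((hβu.pow 3).neg.mul hB₆) e
    · -- row (≥3, 4, 5)
      obtain ⟨β', hβ'⟩ := (not_isUnit_iff_dvd h3 _).mp hβu
      refine Or.inr (Or.inr (Or.inr ⟨hβu, hB₄, ⟨3 * β' ^ 2 - 8 * B₄', ?_⟩, ?_, ?_⟩))
      · rw [hc₄, hβ', hB₄']; ring
      · have e : 1 * W.c₆ = 3 ^ 4 * (-(8 * B₆) + 3 * (-(3 * β' ^ 3) + 12 * β' * B₄')) := by
          rw [hc₆, hβ', hB₄']; ring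
        exact addVal_toNat_eq_of_eq_add h3 isUnit_one (h8.mul hB₆).neg e
      · have e : 4 * W.Δ = 3 ^ 5 * (-(4 * B₆ ^ 2) +
            3 * (-(3 * β' ^ 3) * B₆ + 9 * β' ^ 2 * B₄' ^ 2 - 32 * B₄' ^ 3 +
              12 * β' * B₄' * B₆)) := by
          rw [hΔ, hβ', hB₄']; ring
        exact addVal_toNat_eq_of_eq_add h3 h4 ((h4.mul (hB₆.pow 2))).neg e


/-- **Exit III (Step 4) at `p = 3`: the exact invariants.** On a model with `3 ∣ a₃, a₄`,
`9 ∣ a₆`, `3 ∣ b₂` and `27 ∤ b₈` (Silverman *ATAEC* IV.9.4, Step 4 fires: type III, `m = 2`),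
write `b₂ = 3β`, `b₄ = 3B₄`, `b₆ = 3B₆`; then `B₄ ∈ Rˣ`, `3 ∣ B₆`, `ord Δ = 3`, and either
`β ∈ Rˣ`: `9 ∣ c₄`, `ord c₆ = 3` (row `(≥2, 3, 3)` with the special condition, `f = 2`), or
`3 ∣ β`: `ord c₄ = 2`, `3⁵ ∣ c₆` (row `(2, ≥5, 3)`, `f = 2`).
[cite: Silverman1994, IV.9.4 Step 4 and Table 4.1] [cite: Rizzo2003, Table II (p. 4), rows III] -/
theorem exitIII_values (h2 : IsUnit (2 : R)) (h3 : Irreducible (3 : R)) (W : WeierstrassCurve R)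
    (ha₃ : (3 : R) ∣ W.a₃) (ha₄ : (3 : R) ∣ W.a₄) (ha₆ : (3 : R) ^ 2 ∣ W.a₆) (hb₂ : (3 : R) ∣ W.b₂)
    (h8 : ¬ (3 : R) ^ 3 ∣ W.b₈) :
    ∃ β B₄ B₆ : R, W.b₂ = 3 * β ∧ W.b₄ = 3 * B₄ ∧ W.b₆ = 3 * B₆ ∧ IsUnit B₄ ∧ (3 : R) ∣ B₆ ∧
      (addVal R W.Δ).toNat = 3 ∧
      ((IsUnit β ∧ (9 : R) ∣ W.c₄ ∧ (addVal R W.c₆).toNat = 3) ∨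
        (¬ IsUnit β ∧ (addVal R W.c₄).toNat = 2 ∧ (243 : R) ∣ W.c₆)) := by
  have hΔ3 := addVal_Δ_toNat_eq_three_of_step4 h3 h2 W ha₃ ha₄ ha₆ hb₂ h8
  obtain ⟨γ, hγ⟩ := ha₃
  obtain ⟨q, hq⟩ := ha₄
  obtain ⟨β, hβ⟩ := hb₂
  have h4 : IsUnit (4 : R) := isUnit_four h2
  have h8u : IsUnit (8 : R) := isUnit_eight h2
  have hr' : ∃ r', W.a₆ = 3 * (3 * r') := by
    obtain ⟨r', hr'⟩ := ha₆
    exact ⟨r', by rw [hr']; ring⟩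
  obtain ⟨r', hr''⟩ := hr'
  have hb₄ := b₄_of_a W 3 hγ hq
  have hb₆ : W.b₆ = 3 ^ 2 * (4 * r' + γ ^ 2) := by
    rw [b₆_of_a W 3 hγ hr'']; ring
  have hb₈ := four_b₈_step4 W 3 hβ hb₄ hb₆
  set B₄ : R := 2 * q + W.a₁ * γ with hB₄def
  have hB₄ : IsUnit B₄ := by
    rw [isUnit_iff_not_dvd h3]
    intro hd
    apply h8
    rw [← h4.dvd_mul_left, hb₈, pow_succ]
    refine mul_dvd_mul_left _ (dvd_sub ⟨β * (4 * r' + γ ^ 2), by ring⟩ ?_)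
    rw [pow_two]; exact dvd_mul_of_dvd_left hd _
  have hb₆' : W.b₆ = 3 * (3 * (4 * r' + γ ^ 2)) := by rw [hb₆]; ring
  have hc₄ := c₄_of_b_three W hβ hb₄
  have hc₆ := c₆_of_b_three W hβ hb₄ hb₆'
  refine ⟨β, B₄, 3 * (4 * r' + γ ^ 2), hβ, hb₄, hb₆', hB₄, dvd_mul_right 3 _, hΔ3, ?_⟩
  by_cases hβu : IsUnit β
  · refine Or.inl ⟨hβu, ⟨β ^ 2 - 8 * B₄, hc₄⟩, ?_⟩
    have e : 1 * W.c₆ = 3 ^ 3 * (-β ^ 3 + 3 * (4 * β * B₄ - 24 * (4 * r' + γ ^ 2))) := by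
      rw [hc₆]; ring
    exact addVal_toNat_eq_of_eq_add h3 isUnit_one (hβu.pow 3).neg e
  · obtain ⟨β', hβ'⟩ := (not_isUnit_iff_dvd h3 _).mp hβu
    refine Or.inr ⟨hβu, ?_, ⟨-(3 * β' ^ 3) + 4 * β' * B₄ - 8 * (4 * r' + γ ^ 2), ?_⟩⟩
    · have e : 1 * W.c₄ = 3 ^ 2 * (-(8 * B₄) + 3 * (3 * β' ^ 2)) := by
        rw [hc₄, hβ']; ring
      exact addVal_toNat_eq_of_eq_add h3 isUnit_one (h8u.mul hB₄).neg e
    · rw [hc₆, hβ']; ring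

/-- **Exit IV (Step 5) at `p = 3`: the exact invariants.** On a model with `3 ∣ a₃, a₄`,
`9 ∣ a₆`, `3 ∣ b₂`, `27 ∣ b₈` and `27 ∤ b₆` (Silverman *ATAEC* IV.9.4, Step 5 fires: type IV,
`m = 3`), write `b₂ = 3β`; then `b₄ = 9B₄`, `b₆ = 9B₆` with `B₆ ∈ Rˣ`, and exactly one of:
`β ∈ Rˣ`: `(ord c₄, ord c₆, ord Δ) = (2, 3, 5)` (`f = 3`); `3 ∣ β`, `B₄ ∈ Rˣ`: `(3, 5, 6)`
(`f = 4`); `3 ∣ β, B₄`: `81 ∣ c₄`, `ord c₆ = 5`, `ord Δ = 7` (row `(≥4, 5, 7)`, `f = 5`).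
[cite: Silverman1994, IV.9.4 Step 5 and Table 4.1] [cite: Rizzo2003, Table II (p. 4), rows IV] -/
theorem exitIV_values (h2 : IsUnit (2 : R)) (h3 : Irreducible (3 : R)) (W : WeierstrassCurve R)
    (ha₃ : (3 : R) ∣ W.a₃) (ha₄ : (3 : R) ∣ W.a₄) (ha₆ : (3 : R) ^ 2 ∣ W.a₆) (hb₂ : (3 : R) ∣ W.b₂)
    (h8 : (3 : R) ^ 3 ∣ W.b₈) (h6 : ¬ (3 : R) ^ 3 ∣ W.b₆) :
    ∃ β B₄ B₆ : R, W.b₂ = 3 * β ∧ W.b₄ = 9 * B₄ ∧ W.b₆ = 9 * B₆ ∧ IsUnit B₆ ∧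
      ((IsUnit β ∧ (addVal R W.c₄).toNat = 2 ∧ (addVal R W.c₆).toNat = 3 ∧
          (addVal R W.Δ).toNat = 5) ∨
        (¬ IsUnit β ∧ IsUnit B₄ ∧ (addVal R W.c₄).toNat = 3 ∧ (addVal R W.c₆).toNat = 5 ∧
          (addVal R W.Δ).toNat = 6) ∨
        (¬ IsUnit β ∧ ¬ IsUnit B₄ ∧ (81 : R) ∣ W.c₄ ∧ (addVal R W.c₆).toNat = 5 ∧
          (addVal R W.Δ).toNat = 7)) := by
  obtain ⟨γ, hγ⟩ := ha₃
  obtain ⟨q, hq⟩ := ha₄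
  obtain ⟨β, hβ⟩ := hb₂
  have h30 : (3 : R) ≠ 0 := h3.ne_zero
  have h4 : IsUnit (4 : R) := isUnit_four h2
  have h8u : IsUnit (8 : R) := isUnit_eight h2
  have h32 : IsUnit (32 : R) := isUnit_32 h2
  have hr' : ∃ r', W.a₆ = 3 * (3 * r') := by
    obtain ⟨r', hr'⟩ := ha₆
    exact ⟨r', by rw [hr']; ring⟩
  obtain ⟨r', hr''⟩ := hr'
  have hb₄₁ := b₄_of_a W 3 hγ hq
  have hb₆ : W.b₆ = 3 ^ 2 * (4 * r' + γ ^ 2) := by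
    rw [b₆_of_a W 3 hγ hr'']; ring
  have hb₈ := four_b₈_step4 W 3 hβ hb₄₁ hb₆
  -- `27 ∣ b₈` forces `3 ∣ 2q + a₁γ`
  have hB₄d : (3 : R) ∣ 2 * q + W.a₁ * γ := by
    have h8' : (3 : R) ^ 3 ∣ 4 * W.b₈ := dvd_mul_of_dvd_right h8 4
    rw [hb₈, pow_succ, mul_dvd_mul_iff_left (pow_ne_zero 2 h30)] at h8'
    have h' : (3 : R) ∣ (2 * q + W.a₁ * γ) ^ 2 := by
      have := dvd_sub (⟨β * (4 * r' + γ ^ 2), by ring⟩ :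
        (3 : R) ∣ 3 * β * (4 * r' + γ ^ 2)) h8'
      rwa [sub_sub_cancel] at this
    exact h3.prime.dvd_of_dvd_pow h'
  obtain ⟨B₄, hB₄'⟩ := hB₄d
  have hb₄ : W.b₄ = 9 * B₄ := by rw [hb₄₁, hB₄']; ring
  -- `27 ∤ b₆` forces `B₆ ∈ Rˣ`
  set B₆ : R := 4 * r' + γ ^ 2 with hB₆def
  have hB₆ : IsUnit B₆ := by
    rw [isUnit_iff_not_dvd h3]
    intro hd; apply h6; rw [hb₆, pow_succ]; exact mul_dvd_mul_left _ hd
  have hb₆' : W.b₆ = 9 * B₆ := by rw [hb₆]; ring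
  have hc₄ : W.c₄ = 9 * (β ^ 2 - 24 * B₄) := by
    simp only [WeierstrassCurve.c₄]; rw [hβ, hb₄]; ring
  have hc₆ : W.c₆ = 27 * (-β ^ 3 + 36 * β * B₄ - 72 * B₆) := by
    simp only [WeierstrassCurve.c₆]; rw [hβ, hb₄, hb₆']; ring
  have hΔ : 4 * W.Δ = 243 * (-β ^ 3 * B₆ + 3 * β ^ 2 * B₄ ^ 2 - 96 * B₄ ^ 3 - 36 * B₆ ^ 2 +
      36 * β * B₄ * B₆) := by
    rw [four_mul_Δ_eq, hβ, hb₄, hb₆']; ring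
  refine ⟨β, B₄, B₆, hβ, hb₄, hb₆', hB₆, ?_⟩
  by_cases hβu : IsUnit β
  · -- row (2, 3, 5)
    refine Or.inl ⟨hβu, ?_, ?_, ?_⟩
    · have e : 1 * W.c₄ = 3 ^ 2 * (β ^ 2 + 3 * (-(8 * B₄))) := by rw [hc₄]; ring
      exact addVal_toNat_eq_of_eq_add h3 isUnit_one (hβu.pow 2) e
    · have e : 1 * W.c₆ = 3 ^ 3 * (-β ^ 3 + 3 * (12 * β * B₄ - 24 * B₆)) := by rw [hc₆]; ring
      exact addVal_toNat_eq_of_eq_add h3 isUnit_one (hβu.pow 3).neg e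
    · have e : 4 * W.Δ = 3 ^ 5 * (-β ^ 3 * B₆ +
          3 * (β ^ 2 * B₄ ^ 2 - 32 * B₄ ^ 3 - 12 * B₆ ^ 2 + 12 * β * B₄ * B₆)) := by
        rw [hΔ]; ring
      exact addVal_toNat_eq_of_eq_add h3 h4 ((hβu.pow 3).neg.mul hB₆) e
  obtain ⟨β', hβ'⟩ := (not_isUnit_iff_dvd h3 _).mp hβu
  have hc₆5 : (addVal R W.c₆).toNat = 5 := by
    have e : 1 * W.c₆ = 3 ^ 5 * (-(8 * B₆) + 3 * (-β' ^ 3 + 4 * β' * B₄)) := by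
      rw [hc₆, hβ']; ring
    exact addVal_toNat_eq_of_eq_add h3 isUnit_one (h8u.mul hB₆).neg e
  by_cases hB₄u : IsUnit B₄
  · -- row (3, 5, 6)
    refine Or.inr (Or.inl ⟨hβu, hB₄u, ?_, hc₆5, ?_⟩)
    · have e : 1 * W.c₄ = 3 ^ 3 * (-(8 * B₄) + 3 * β' ^ 2) := by rw [hc₄, hβ']; ring
      exact addVal_toNat_eq_of_eq_add h3 isUnit_one (h8u.mul hB₄u).neg e
    · have e : 4 * W.Δ = 3 ^ 6 * (-32 * B₄ ^ 3 +
          3 * (-(3 * β' ^ 3) * B₆ + 3 * β' ^ 2 * B₄ ^ 2 - 4 * B₆ ^ 2 + 12 * β' * B₄ * B₆)) := by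
        rw [hΔ, hβ']; ring
      exact addVal_toNat_eq_of_eq_add h3 h4 (h32.neg.mul (hB₄u.pow 3)) e
  · -- row (≥4, 5, 7)
    obtain ⟨B₄', hB₄''⟩ := (not_isUnit_iff_dvd h3 _).mp hB₄u
    refine Or.inr (Or.inr ⟨hβu, hB₄u, ⟨β' ^ 2 - 8 * B₄', ?_⟩, hc₆5, ?_⟩)
    · rw [hc₄, hβ', hB₄'']; ring
    · have e : 4 * W.Δ = 3 ^ 7 * (-(4 * B₆ ^ 2) +
          3 * (-(96 * B₄' ^ 3) - β' ^ 3 * B₆ + 9 * β' ^ 2 * B₄' ^ 2 + 12 * β' * B₄' * B₆)) := by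
        rw [hΔ, hβ', hB₄'']; ring
      exact addVal_toNat_eq_of_eq_add h3 h4 (h4.mul (hB₆.pow 2)).neg e

end Exits

end TateAlgorithm

end Literature.NumberTheory.DiophantineGeometry
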